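import Literature.Topology.FourManifolds.SphereTrisectionsSectors
import Literature.Topology.FourManifolds.TrisectionEuler
import Literature.Topology.FourManifolds.SPC4Wave0
import Literature.Topology.FourManifolds.HomotopyS4CompactProofs
import Literature.Topology.FourManifolds.HomotopyS4OrientableProofs
import Literature.AlgebraicTopology.FundamentalGroup.SphereSimplyConnected
import Literature.Topology.FourManifolds.GluckTwistMeridian
import HarnessLib

/-!
# Abrams–Gay–Kirby, Cor. 6 (SPC4 ⟺ every `(3k, k)`-trisection of `{1}` is stably trivial): assembly

Sibling of `TrisectionFunctor.lean` / `TrisectionFunctorGK.lean` (fact item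
`provefact-Literature.Topology.FourManifolds.spc4_iff_forall_isStablyTrivial`).  The named fact (f)
`spc4_iff_forall_isStablyTrivial` of `TrisectionFunctor.lean` is Abrams–Gay–Kirby's Corollary 6.
This file makes its printed three-line proof explicit and PROVES the corollary, at universe `0`
(the universe of `SmoothPoincare4`), from named facts of the tree — Gay–Kirby's Thm. 4
(`exists_isBalancedGKTrisection`) and Remark 2 (`gkTrisection_genus_eq_sum_of_homotopyEquiv_sphere`),
the parts (a′), (b′), (c′), (e′) of Abrams–Gay–Kirby's Thm. 5 and the marking fact (g′)
(`TrisectionFunctorGK.lean`), the homotopy-sphere criterion `spc4.S10`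
(`nonempty_homotopyEquiv_sphere_four_iff`, `SPC4Wave0.lean`) — and two further leaves vendored
here as named facts: (h) the homological content of the printed proof of Cor. 6 (a
`(3k, k)`-trisected simply connected 4-manifold has `χ = 2`, whence `H₂ = 0`) and (i) the last
sentence of Thm. 5 with Gay–Kirby's Thm. 11 (diffeomorphic trisected 4-manifolds have stably
isomorphic group trisections).  The unconditional `spc4_iff_forall_isStablyTrivial_holds` would
need proofs of these leaves (Morse 2-functions/Cerf theory for GK Thms. 4, 11; handlebody
fillings, Laudenbach–Poénaru and the 3-dimensional Poincaré conjecture for AGK Thm. 5) and is NOT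
claimed.

## The source, as printed (Geom. Topol. 22 (2018) 1537–1545 = arXiv:1605.06731, same numbering)

* Cor. 6 (p. 1541): "The smooth 4-dimensional Poincaré conjecture is equivalent to the following
  statement: 'Every `(3k, k)`-trisection of the trivial group is stably equivalent to the trivial
  trisection of the trivial group.'"  Proof (ibid.): "A `(3k, k)`-trisection of the trivial group
  gives a `(3k, k)`-trisection of a simply connected 4-manifold. The Euler characteristic of a
  `(g, k)`-trisected 4-manifold is `2 − g + 3k` [Gay–Kirby, Remark 2: `2 + g − 3k`; both are `2`
  at `g = 3k`], so in this case we have an Euler characteristic `2` simply connected 4-manifold,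
  i.e. a homotopy `S⁴`."
* Thm. 5 (p. 1541): "`ℳ ∘ 𝒢` is the identity up to trisected diffeomorphism and `𝒢 ∘ ℳ` is the
  identity up to trisected isomorphism. … the standard `(3, 1)`-trisection of `{1}` maps to the
  standard `(3, 1)`-trisection of `S⁴`, and connected sums of group trisections map to connected
  sums of 4-manifold trisections. Thus `ℳ` induces a bijection between the set of trisected groups
  modulo isomorphism and stabilization and the set of smooth, closed, connected, oriented
  4-manifolds modulo orientation preserving diffeomorphism."  Its proof ends (p. 1542): "any two
  trisections of the same 4-manifold become isotopic after performing some number of connected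
  sums with the standard `(3, 1)`-trisection of `S⁴` [Gay–Kirby, Thm. 11]. The connected sum
  operation and the `(3, 1)`-trisection on the group side are constructed exactly to correspond to
  stabilization of manifolds via the map `ℳ`."

## Architecture (`𝒢(T, x₀, μ)` = `groupGKTrisectionOf`, over `IsBalancedGKTrisection`)

**(RHS ⇒ SPC4)** `spc4_of_forall_isStablyTrivial_of_facts`.  `M ≃ₕ S⁴` is compact, orientable,
simply connected (`compactSpace_of_homotopyEquiv_sphere_four_holds`,
`isOrientable_of_homotopyEquiv_sphere_four_holds`, `simplyConnectedSpace_sphere_four_holds` — all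
PROVED in the tree); GK Thm. 4 trisects it, `χ = 2` gives `g = 3k` (GK Remark 2); mark ((g′)); by
(a′) the kernel triple `K` is a `(3k, k)` trisection of `π₁ M ≃* 1`, hence stably trivial by the
RHS: `Iso (K.stabilizeIter n) (s4Kernels.stabilizeIter m)`, `3 + 3m = 3k + 3n`; iterate (c′)
`n` times, re-marking so that `Iso` becomes `=` (`exists_marking_groupGKTrisectionOf_eq`), to get a
`(3k + 3n, k + n)`-trisection of `M` with kernel triple `K.stabilizeIter n`; compare with the
`(3 + 3m, 1 + m)`-trisection of `S⁴` ((d′), supplied by (c′): `sphere_gkTrisections_of_stabilization`)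
and conclude by rigidity (b′).

**(SPC4 ⇒ RHS)** `forall_isStablyTrivial_of_spc4_of_facts`.  A `(3k, k)` trisection `K` of `{1}`
is, after re-marking, the kernel triple of a trisected closed connected oriented `X` ((e′)); by
(a′) `π₁(X, x₀) ≃* S_g/⟪K₁ ∪ K₂ ∪ K₃⟫ ≃* 1`, so `X` is simply connected (a connected manifold is
path connected); by (h) `H₂(X; ℤ) = 0`, so by `spc4.S10` `X ≃ₕ S⁴`, and by SPC4 `X ≃ₘ S⁴`; the
standard `(3, 1)`-trisection of `S⁴` realises `s4Kernels` ((d′) at `m = 0`); (i) applied to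
`(X, T)` and `(S⁴, standard)` gives `Iso (K.stabilizeIter n) (s4Kernels.stabilizeIter n')` with
`3 + 3n' = 3k + 3n`.

## Faithfulness notes

* (h) is the sentence "Euler characteristic `2` simply connected 4-manifold" of the printed proof
  unpacked homologically (`χ = 2 + g − 3k = 2`, `H₀ ≅ H₄ ≅ ℤ`, `H₁ = H₃ = 0`, so `H₂` is free of
  rank `χ − 2 = 0`), with "simply connected" read as `SimplyConnectedSpace` and `H₂(X; ℤ)` the
  tree's `singularHomologyZ X 2`; the remaining step "i.e. a homotopy `S⁴`" is the catalogued leaf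
  `spc4.S10` (`nonempty_homotopyEquiv_sphere_four_iff`, decomposed in `HomotopyS4Criterion.lean`),
  taken as a separate hypothesis; `nonempty_homotopyEquiv_sphere_of_gkTrisection_three_mul`
  recombines the two (proved).
* (i): see its docstring (unoriented diffeomorphism suffices because `TrisectionKernels.Iso`
  allows all of `Aut(S_g)`; stated for all markings, exactly as (c′)).
* Universe: (f) is universe-polymorphic; the assembly is at universe `0` (`S⁴ : Type`, and (b′)
  compares two manifolds of one universe).  The last section shows that (f) does not depend on
  the universe (`spc4_iff_forall_isStablyTrivial_univ_of_univ`: smooth structures are transported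
  to `Shrink` copies, trivial groups are interchangeable), so the universe-`0` assembly gives (f)
  at every universe (`spc4_iff_forall_isStablyTrivial_of_facts_univ`, the shape of `…_holds`).

## References

* [AbramsGayKirby2018] A. Abrams, D. Gay, R. Kirby, *Group trisections and smooth 4-manifolds*,
  Geom. Topol. 22 (2018) 1537–1545: Def. 1 (p. 1538), Def. 3 (p. 1540), Thm. 5 and Cor. 6 with its
  proof (p. 1541), proof of Thm. 5 (pp. 1541–1542).
* [GayKirby2016] D. Gay, R. Kirby, *Trisecting 4-manifolds*, Geom. Topol. 20 (2016) 3097–3132: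
  Def. 1, Remark 2, Thm. 4 (p. 3098), Def. 8, Lemma 10 (pp. 3099–3100), Thm. 11 (p. 3101), §2.
* [HatcherAT2002] A. Hatcher, *Algebraic Topology*, Prop. 1.14, Thm. 2A.1, Thm. 3.2, Cor. 3.37;
  [FreedmanQuinnPMS1990] M. Freedman, F. Quinn, *Topology of 4-manifolds*, §10.1.
-/

noncomputable section

open Set ContinuousMap CategoryTheory
open scoped Manifold ContDiff

namespace Literature.Topology.FourManifolds

universe u

/-- The round 4-sphere `S⁴ ⊆ ℝ⁵` with Mathlib's smooth structure. [folklore] -/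
local notation "𝕊⁴" => (Metric.sphere (0 : EuclideanSpace ℝ (Fin 5)) 1)

/-! ### Two further leaves of Cor. 6, as named facts -/

/-- **(h) Abrams–Gay–Kirby, proof of Cor. 6, with Gay–Kirby, Remark 2: a `(3k, k)`-trisected
simply connected closed 4-manifold has `H₂ = 0`.**  Let `X` be a closed, connected, oriented
smooth 4-manifold carrying a balanced `(3k, k)`-trisection (with corners along the central
surface, `IsBalancedGKTrisection`), and assume `X` is simply connected.  Then `H₂(X; ℤ) = 0`
(`singularHomologyZ X 2`, the coefficient convention of `spc4.S10`).  Print (AGK p. 1541, proof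
of Cor. 6): "A `(3k, k)`-trisection of the trivial group gives a `(3k, k)`-trisection of a simply
connected 4-manifold. The Euler characteristic of a `(g, k)`-trisected 4-manifold is `2 − g + 3k`
[Gay–Kirby 2016, Remark 2: "`χ(X) = 2 + g − 3k`"; either way `χ = 2` when `g = 3k`], so in this
case we have an Euler characteristic `2` simply connected 4-manifold, i.e. a homotopy `S⁴`."  The
homological unpacking of "Euler characteristic `2` simply connected": `H₀ ≅ H₄ ≅ ℤ`, `H₁ = 0`
(Hurewicz, Hatcher Thm. 2A.1), `H₃ ≅ H¹ ≅ Hom(H₁, ℤ) = 0` and `H₂ ≅ H²` free of rank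
`b₂ = χ − 2 = 0` (Poincaré duality and universal coefficients, Hatcher Thm. 3.2, Cor. 3.37), so
`H₂(X; ℤ) = 0`; the last printed step "i.e. a homotopy `S⁴`" is the catalogued leaf `spc4.S10`
(`nonempty_homotopyEquiv_sphere_four_iff`), see `nonempty_homotopyEquiv_sphere_of_gkTrisection_three_mul`.
Not proved here (the tree has Betti numbers but no Euler characteristic of a trisected manifold).
Users take `(h : isZero_singularHomologyZ_two_of_gkTrisection_three_mul)`.
[cite: AbramsGayKirby2018, Cor. 6, proof (p. 1541)] [cite: GayKirby2016, Remark 2] -/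
def isZero_singularHomologyZ_two_of_gkTrisection_three_mul : Prop :=
  ∀ (X : Type u) [TopologicalSpace X] [T2Space X] [SecondCountableTopology X]
    [ChartedSpace (EuclideanSpace ℝ (Fin 4)) X] [IsManifold (𝓡 4) ∞ X] [CompactSpace X]
    [ConnectedSpace X] (_ : SmoothOrientation (𝓡 4) X) (k : ℕ) (S : Fin 3 → Set X),
    IsBalancedGKTrisection X (3 * k) k S → SimplyConnectedSpace X →
      Limits.IsZero (singularHomologyZ X 2)

/-- **(i) Abrams–Gay–Kirby, Thm. 5 (injectivity of `ℳ` modulo isomorphism and stabilisation) with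
Gay–Kirby, Thm. 11 (uniqueness of trisections up to stabilisation).**  Let `X`, `X'` be closed,
connected, oriented smooth 4-manifolds with balanced Gay–Kirby trisections `S` (type `(g, k)`) and
`S'` (type `(g', k')`), base points and markings of their central surfaces.  If `X` and `X'` are
diffeomorphic, then the two kernel triples become isomorphic after stabilising each some number
of times: `Iso ((𝒢 S).stabilizeIter n) ((𝒢 S').stabilizeIter n')` with `g' + 3n' = g + 3n` (the
genus bookkeeping is the explicit equation used to transport, as in
`TrisectionKernels.IsStablyTrivial`).  Print, Thm. 5 (p. 1541): "`𝒢 ∘ ℳ` is the identity up to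
trisected isomorphism … connected sums of group trisections map to connected sums of 4-manifold
trisections. Thus `ℳ` induces a bijection between the set of trisected groups modulo isomorphism
and stabilization and the set of smooth, closed, connected, oriented 4-manifolds modulo
orientation preserving diffeomorphism"; proof (p. 1542): "any two trisections of the same
4-manifold become isotopic after performing some number of connected sums with the standard
`(3, 1)`-trisection of `S⁴`" (Gay–Kirby 2016, Thm. 11) "… The connected sum operation and the
`(3, 1)`-trisection on the group side are constructed exactly to correspond to stabilization of
manifolds via the map `ℳ`."  Reading: carry `S` along the diffeomorphism to a trisection of `X'`
(Gay–Kirby's Def. 1 does not involve the orientation, so a diffeomorphism of either sign will do,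
and the kernel triple is unchanged up to `Iso`); GK Thm. 11 makes it isotopic to `S'` after `n`,
`n'` stabilisations; isotopic trisections have isomorphic kernel triples and the kernel triple of
an `n`-fold stabilisation is the `n`-fold algebraic stabilisation (AGK Def. 3, Thm. 5).  As in (b′),
`TrisectionKernels.Iso` allows all of `Aut(S_g)` (Dehn–Nielsen–Baer), which is why no orientation
condition is needed on the diffeomorphism, and the statement is made for all markings (they change
kernel triples by `Iso`, `groupGKTrisectionOf_iso_of_markings`), exactly as (c′).  Not proved in
the tree.  Users take `(h : stablyIso_groupGKTrisectionOf_of_diffeomorphic)`.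
[cite: AbramsGayKirby2018, Thm. 5 (p. 1541) and its proof (p. 1542)] [cite: GayKirby2016, Thm. 11] -/
def stablyIso_groupGKTrisectionOf_of_diffeomorphic : Prop :=
  ∀ (X : Type u) [TopologicalSpace X] [T2Space X] [SecondCountableTopology X]
    [ChartedSpace (EuclideanSpace ℝ (Fin 4)) X] [IsManifold (𝓡 4) ∞ X] [CompactSpace X]
    [ConnectedSpace X] (_ : SmoothOrientation (𝓡 4) X)
    (X' : Type u) [TopologicalSpace X'] [T2Space X'] [SecondCountableTopology X']
    [ChartedSpace (EuclideanSpace ℝ (Fin 4)) X'] [IsManifold (𝓡 4) ∞ X'] [CompactSpace X']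
    [ConnectedSpace X'] (_ : SmoothOrientation (𝓡 4) X')
    (g k g' k' : ℕ) (S : Fin 3 → Set X) (S' : Fin 3 → Set X')
    (h : IsBalancedGKTrisection X g k S) (h' : IsBalancedGKTrisection X' g' k' S')
    (x₀ : centralSurface S) (x₀' : centralSurface S')
    (μ : SurfaceGroup g ≃* FundamentalGroup (centralSurface S) x₀)
    (μ' : SurfaceGroup g' ≃* FundamentalGroup (centralSurface S') x₀'),
    Nonempty (X ≃ₘ⟮𝓡 4, 𝓡 4⟯ X') →
      ∃ (n n' : ℕ) (e : g' + 3 * n' = g + 3 * n),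
        TrisectionKernels.Iso ((groupGKTrisectionOf h x₀ μ).stabilizeIter n)
          (((groupGKTrisectionOf h' x₀' μ').stabilizeIter n').cast e)

/-! ### Glue (proved) -/

/-- **The printed proof of Cor. 6, recombined: a `(3k, k)`-trisected simply connected closed
4-manifold is a homotopy `S⁴`** (universe `0`), GIVEN (h) (`χ = 2`, so `H₂ = 0`) and `spc4.S10`
(`nonempty_homotopyEquiv_sphere_four_iff`: a closed 4-manifold is `≃ S⁴` iff simply connected with
`H₂ = 0`; Hurewicz, Whitehead, Poincaré duality — Freedman–Quinn §10.1).  Print: "an Euler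
characteristic `2` simply connected 4-manifold, i.e. a homotopy `S⁴`."
[cite: AbramsGayKirby2018, Cor. 6, proof (p. 1541)] -/
theorem nonempty_homotopyEquiv_sphere_of_gkTrisection_three_mul
    (hh : isZero_singularHomologyZ_two_of_gkTrisection_three_mul.{0})
    (hS10 : nonempty_homotopyEquiv_sphere_four_iff.{0})
    (X : Type) [TopologicalSpace X] [T2Space X] [SecondCountableTopology X]
    [ChartedSpace (EuclideanSpace ℝ (Fin 4)) X] [IsManifold (𝓡 4) ∞ X] [CompactSpace X]
    [ConnectedSpace X] (o : SmoothOrientation (𝓡 4) X) (k : ℕ) (S : Fin 3 → Set X)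
    (hS : IsBalancedGKTrisection X (3 * k) k S) [SimplyConnectedSpace X] : Nonempty (X ≃ₕ 𝕊⁴) :=
  (hS10 X).mpr ⟨inferInstance, hh X o k S hS inferInstance⟩

/-- Transport of the group-trisection property along an isomorphism of the trisected group: only
the identification of the triple pushout changes. [folklore] -/
theorem IsGroupTrisection.of_mulEquiv {g k : ℕ} {G G' : Type*} [Group G] [Group G']
    {K : TrisectionKernels g} (hK : IsGroupTrisection g k G K) (e : G ≃* G') :
    IsGroupTrisection g k G' K :=
  ⟨hK.normal, hK.free_quotient, hK.free_pairQuotient, hK.triple.map fun f => f.trans e⟩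

/-- A trisection of a subsingleton group is a trisection of the trivial group `PUnit` (any
universe). [folklore] -/
theorem IsGroupTrisection.punit_of_subsingleton {g k : ℕ} {G : Type*} [Group G] [Subsingleton G]
    {K : TrisectionKernels g} (hK : IsGroupTrisection g k G K) :
    IsGroupTrisection g k (PUnit : Type u) K :=
  letI : Unique G := uniqueOfSubsingleton 1
  hK.of_mulEquiv (MulEquiv.ofUnique : G ≃* PUnit.{u + 1})

/-- The trisected group of a group trisection of a subsingleton group: if `K` is a trisection of
both `G` and `G'` and `G'` is a subsingleton, so is `G` (both are `≃* S_g/⟪K₁ ∪ K₂ ∪ K₃⟫`).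
[folklore] -/
theorem IsGroupTrisection.subsingleton_of_subsingleton {g k k' : ℕ} {G G' : Type*} [Group G]
    [Group G'] [Subsingleton G'] {K : TrisectionKernels g} (hK : IsGroupTrisection g k G K)
    (hK' : IsGroupTrisection g k' G' K) : Subsingleton G := by
  obtain ⟨e⟩ := hK.triple
  obtain ⟨e'⟩ := hK'.triple
  exact (e.symm.trans e').toEquiv.subsingleton

/-- A connected topological 4-manifold whose fundamental group at one point is trivial is simply
connected: a manifold is locally path connected, hence (being connected) path connected, and
then one base point suffices
(`Literature.AlgebraicTopology.FundamentalGroup.simplyConnectedSpace_of_loops_nullhomotopic_at`,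
of which this is the manifold wrapper). [folklore] -/
theorem simplyConnectedSpace_of_subsingleton_fundamentalGroup {X : Type*} [TopologicalSpace X]
    [ChartedSpace (EuclideanSpace ℝ (Fin 4)) X] [ConnectedSpace X] (x₀ : X)
    [Subsingleton (FundamentalGroup X x₀)] : SimplyConnectedSpace X := by
  haveI : LocallyPathConnectedSpace X :=
    ChartedSpace.locallyPathConnectedSpace (EuclideanSpace ℝ (Fin 4)) X
  haveI : PathConnectedSpace X := pathConnectedSpace_iff_connectedSpace.mpr ‹_›
  exact Literature.AlgebraicTopology.FundamentalGroup.simplyConnectedSpace_of_loops_nullhomotopic_at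
    x₀ fun γ => Path.Homotopic.Quotient.eq.mp (Subsingleton.elim (α := FundamentalGroup X x₀)
      (Path.Homotopic.Quotient.mk γ) (Path.Homotopic.Quotient.mk (Path.refl x₀)))

/-- **Iterated stabilisation on the manifold side.**  GIVEN the stabilisation fact (c′)
`exists_stabilized_gkTrisection` (AGK Def. 3 / Thm. 5 with GK Lemma 10), a balanced
`(g, k)`-trisection of a closed connected oriented smooth `X` with a marking yields, for every `n`,
a balanced `(g + 3n, k + n)`-trisection of `X` with a marking whose kernel triple is *equal* to
the `n`-fold algebraic stabilisation of the original one (re-marking absorbs the isomorphism at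
each step, `exists_marking_groupGKTrisectionOf_eq`).
[cite: AbramsGayKirby2018, Def. 3 (p. 1540) and Thm. 5 (p. 1541)] -/
theorem exists_gkTrisection_stabilizeIter (hc : exists_stabilized_gkTrisection.{u})
    (X : Type u) [TopologicalSpace X] [T2Space X] [SecondCountableTopology X]
    [ChartedSpace (EuclideanSpace ℝ (Fin 4)) X] [IsManifold (𝓡 4) ∞ X] [CompactSpace X]
    [ConnectedSpace X] (o : SmoothOrientation (𝓡 4) X) {g k : ℕ} {S : Fin 3 → Set X}
    (h : IsBalancedGKTrisection X g k S) (x₀ : centralSurface S)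
    (μ : SurfaceGroup g ≃* FundamentalGroup (centralSurface S) x₀) (n : ℕ) :
    ∃ (S' : Fin 3 → Set X) (h' : IsBalancedGKTrisection X (g + 3 * n) (k + n) S')
      (x₀' : centralSurface S')
      (μ' : SurfaceGroup (g + 3 * n) ≃* FundamentalGroup (centralSurface S') x₀'),
      groupGKTrisectionOf h' x₀' μ' = (groupGKTrisectionOf h x₀ μ).stabilizeIter n := by
  induction n with
  | zero => exact ⟨S, h, x₀, μ, rfl⟩
  | succ n ih =>
    obtain ⟨Sₙ, hₙ, xₙ, μₙ, hK⟩ := ih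
    obtain ⟨S', h', x', μ', hiso⟩ := hc X o (g + 3 * n) (k + n) Sₙ hₙ xₙ μₙ
    rw [hK] at hiso
    obtain ⟨μ'', hμ''⟩ := exists_marking_groupGKTrisectionOf_eq h' x' μ' hiso
    exact ⟨S', h', x', μ'', hμ''⟩

/-- **The standard `(3, 1)`-trisection of `S⁴` realises `s4Kernels` on the nose** (GIVEN (d′)
`sphere_gkTrisections`, at `m = 0`, re-marked): the round `S⁴` has a balanced `(3, 1)`-trisection
with corners and a marking whose kernel triple equals the genus-`3` `S⁴` triple
`(⟪a₁, a₂, b₃⟫, ⟪a₁, b₂, a₃⟫, ⟪b₁, a₂, a₃⟫)`.  Print, AGK Thm. 5: "the standard `(3, 1)`-trisection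
of `{1}` maps to the standard `(3, 1)`-trisection of `S⁴`".
[cite: AbramsGayKirby2018, Thm. 5 (p. 1541)] -/
theorem exists_sphere_gkTrisection_three_one (hd : sphere_gkTrisections) :
    ∃ (S : Fin 3 → Set 𝕊⁴) (h : IsBalancedGKTrisection 𝕊⁴ 3 1 S) (x₀ : centralSurface S)
      (μ : SurfaceGroup 3 ≃* FundamentalGroup (centralSurface S) x₀),
      groupGKTrisectionOf h x₀ μ = s4Kernels := by
  obtain ⟨S, h, x₀, μ, hiso⟩ := hd 0
  obtain ⟨μ', hμ'⟩ := exists_marking_groupGKTrisectionOf_eq h x₀ μ hiso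
  exact ⟨S, h, x₀, μ', hμ'⟩

/-- The last step of (RHS ⇒ SPC4): GIVEN rigidity (b′), a trisected `M` and a trisected `S⁴` whose
kernel triples are isomorphic to a transport `K₂.cast e`, resp. to `K₂`, are diffeomorphic (the
genus equation `e` is eliminated by `subst`). [cite: AbramsGayKirby2018, Thm. 5 (p. 1541)] -/
theorem nonempty_diffeomorph_sphere_of_iso_cast (hb : diffeomorph_of_iso_groupGKTrisectionOf.{0})
    {M : Type} [TopologicalSpace M] [T2Space M] [SecondCountableTopology M]
    [ChartedSpace (EuclideanSpace ℝ (Fin 4)) M] [IsManifold (𝓡 4) ∞ M] [CompactSpace M]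
    [ConnectedSpace M] (o : SmoothOrientation (𝓡 4) M) (o' : SmoothOrientation (𝓡 4) 𝕊⁴)
    {G kM : ℕ} {T : Fin 3 → Set M} (hT : IsBalancedGKTrisection M G kM T)
    (y₀ : centralSurface T) (ν : SurfaceGroup G ≃* FundamentalGroup (centralSurface T) y₀)
    {G₂ k₂ : ℕ} {S' : Fin 3 → Set 𝕊⁴} (hS' : IsBalancedGKTrisection 𝕊⁴ G₂ k₂ S')
    (x₀' : centralSurface S')
    (μ' : SurfaceGroup G₂ ≃* FundamentalGroup (centralSurface S') x₀')
    (K₂ : TrisectionKernels G₂)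
    (hK₂ : TrisectionKernels.Iso (groupGKTrisectionOf hS' x₀' μ') K₂)
    (e : G₂ = G) (ek : k₂ = kM)
    (hIso : TrisectionKernels.Iso (groupGKTrisectionOf hT y₀ ν) (K₂.cast e)) :
    Nonempty (M ≃ₘ⟮𝓡 4, 𝓡 4⟯ 𝕊⁴) := by
  subst e ek
  rw [TrisectionKernels.cast_rfl] at hIso
  exact nonempty_diffeomorph_of_iso_groupGKTrisectionOf hb o o' hT hS' y₀ x₀' ν μ' hIso hK₂

/-! ### Cor. 6, direction RHS ⇒ SPC4 -/

/-- **Abrams–Gay–Kirby, Cor. 6, the direction "every `(3k, k)`-trisection of `{1}` stably trivial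
⇒ SPC4", from named facts** (universe `0`).  GIVEN Gay–Kirby Thm. 4 (`hGK`), GK Remark 2 in its
homotopy-sphere form (`hχ`), the marking fact (g′) (`hg`), and the parts (a′) `𝒢` is a group
trisection of `π₁` (`ha`), (b′) rigidity (`hb`), (c′) stabilisation (`hc`) of AGK Thm. 5, together
with (d′) the standard trisections of `S⁴` (`hd`): if every `(3k, k)` group trisection of the
trivial group is stably trivial, then every smooth 4-manifold homotopy equivalent to `S⁴` is
diffeomorphic to `S⁴`.  Proof: the (RHS ⇒ SPC4) paragraph of the module docstring.
[cite: AbramsGayKirby2018, Cor. 6 (p. 1541)] -/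
theorem spc4_of_forall_isStablyTrivial_of_facts
    (hGK : exists_isBalancedGKTrisection.{0})
    (hχ : gkTrisection_genus_eq_sum_of_homotopyEquiv_sphere.{0})
    (hg : exists_marking_centralSurface_of_gkTrisection.{0})
    (ha : isGroupTrisection_groupGKTrisectionOf.{0})
    (hb : diffeomorph_of_iso_groupGKTrisectionOf.{0})
    (hc : exists_stabilized_gkTrisection.{0})
    (hd : sphere_gkTrisections)
    (hst : ∀ (k : ℕ) (K : TrisectionKernels (3 * k)),
      IsGroupTrisection (3 * k) k (PUnit : Type) K → K.IsStablyTrivial)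
    (M : Type) [TopologicalSpace M] [T2Space M] [SecondCountableTopology M] :
    ContinuousMap.HomotopyEquiv.NonemptyDiffeomorphSphere M 4 := by
  intro _ _ e
  -- packaging of `M ≃ₕ S⁴` (all proved in the tree)
  haveI : CompactSpace M := compactSpace_of_homotopyEquiv_sphere_four_holds M e
  obtain ⟨o⟩ := isOrientable_of_homotopyEquiv_sphere_four_holds M e
  haveI : SimplyConnectedSpace 𝕊⁴ := simplyConnectedSpace_sphere_four_holds
  haveI : SimplyConnectedSpace M := e.simplyConnectedSpace
  obtain ⟨o'⟩ := isOrientable_sphere_holds 4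
  -- trisect `M`; `χ = 2` forces `g = 3k`
  obtain ⟨g, k, S, -, hS⟩ := hGK M o
  obtain rfl : g = 3 * k := hχ.balanced M o hS e
  -- mark the central surface; the kernel triple is a `(3k, k)` trisection of `π₁ M = 1`
  obtain ⟨x₀, ⟨μ⟩⟩ := hg M o (3 * k) k S hS
  have hK : IsGroupTrisection (3 * k) k (PUnit : Type) (groupGKTrisectionOf hS x₀ μ) :=
    (ha M o (3 * k) k S hS x₀ μ).punit_of_subsingleton
  -- the hypothesis: stably trivial
  obtain ⟨n, m, hnm, hiso⟩ := hst k _ hK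
  -- stabilise `n` times on the manifold side, with equality of kernel triples
  obtain ⟨Sₙ, hₙ, xₙ, μₙ, hEq⟩ := exists_gkTrisection_stabilizeIter hc M o hS x₀ μ n
  rw [← hEq] at hiso
  -- the `(3 + 3m, 1 + m)`-trisection of `S⁴`
  obtain ⟨S', hS', x', μ', hiso'⟩ := hd m
  exact nonempty_diffeomorph_sphere_of_iso_cast hb o o' hₙ xₙ μₙ hS' x' μ' _ hiso' hnm
    (by omega) hiso

/-! ### Cor. 6, direction SPC4 ⇒ RHS -/

/-- **Abrams–Gay–Kirby, Cor. 6, the direction "SPC4 ⇒ every `(3k, k)`-trisection of `{1}` is stably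
trivial", from named facts** (universe `0`).  GIVEN the surjectivity half (e′) of AGK Thm. 5 (`he`),
(a′) (`ha`), the homological content (h) of the printed proof of Cor. 6 (`hh`), the homotopy-sphere
criterion `spc4.S10` (`hS10`), the injectivity-modulo-stabilisation half of Thm. 5 with GK Thm. 11
(i) (`hi`), and (d′) (`hd`, used at `m = 0`: the standard `(3, 1)`-trisection of `S⁴` realises
`s4Kernels`): if SPC4 holds then every `(3k, k)` group trisection `K` of the trivial group is
stably trivial.  Proof: the (SPC4 ⇒ RHS) paragraph of the module docstring.
[cite: AbramsGayKirby2018, Cor. 6 (p. 1541)] -/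
theorem forall_isStablyTrivial_of_spc4_of_facts
    (he : exists_gkTrisected_of_isGroupTrisection.{0})
    (ha : isGroupTrisection_groupGKTrisectionOf.{0})
    (hh : isZero_singularHomologyZ_two_of_gkTrisection_three_mul.{0})
    (hS10 : nonempty_homotopyEquiv_sphere_four_iff.{0})
    (hi : stablyIso_groupGKTrisectionOf_of_diffeomorphic.{0})
    (hd : sphere_gkTrisections)
    (spc4 : ∀ (M : Type) [TopologicalSpace M] [T2Space M] [SecondCountableTopology M],
      ContinuousMap.HomotopyEquiv.NonemptyDiffeomorphSphere M 4)
    (k : ℕ) (K : TrisectionKernels (3 * k)) (hK : IsGroupTrisection (3 * k) k (PUnit : Type) K) :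
    K.IsStablyTrivial := by
  -- realise `K` by a trisected closed connected oriented smooth `X`, exactly after re-marking
  obtain ⟨X, _, _, _, _, _, _, _, o, S, hS, x₀, μ, hiso⟩ := he (3 * k) k PUnit K hK
  obtain ⟨μ', hμ'⟩ := exists_marking_groupGKTrisectionOf_eq hS x₀ μ hiso
  -- `π₁(X, x₀) = 1`, hence `X` is simply connected
  have hπ := ha X o (3 * k) k S hS x₀ μ'
  rw [hμ'] at hπ
  haveI : Subsingleton (FundamentalGroup X (x₀ : X)) := hπ.subsingleton_of_subsingleton hK
  haveI : SimplyConnectedSpace X := simplyConnectedSpace_of_subsingleton_fundamentalGroup (x₀ : X)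
  -- `H₂ X = 0` (printed proof of Cor. 6), so `X ≃ₕ S⁴` (`spc4.S10`) and `X ≃ₘ S⁴` (SPC4)
  obtain ⟨e⟩ := nonempty_homotopyEquiv_sphere_of_gkTrisection_three_mul hh hS10 X o k S hS
  have hφ : Nonempty (X ≃ₘ⟮𝓡 4, 𝓡 4⟯ 𝕊⁴) := spc4 X inferInstance inferInstance e
  -- the standard `(3, 1)`-trisection of `S⁴` realises `s4Kernels`
  obtain ⟨S', hS', x', μ'', hμ''⟩ := exists_sphere_gkTrisection_three_one hd
  obtain ⟨o'⟩ := isOrientable_sphere_holds 4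
  -- injectivity modulo stabilisation
  obtain ⟨n, n', hnn, hI⟩ := hi X o 𝕊⁴ o' (3 * k) k 3 1 S S' hS hS' x₀ x' μ' μ'' hφ
  rw [hμ', hμ''] at hI
  exact ⟨n, n', hnn, hI⟩

/-! ### Cor. 6 assembled -/

/-- **Abrams–Gay–Kirby, Cor. 6 — the named fact (f) `spc4_iff_forall_isStablyTrivial` at universe
`0`, PROVED from named facts of the tree**: Gay–Kirby Thm. 4 (`hGK`) and Remark 2 (`hχ`), the
marking fact (g′) (`hg`), the parts (a′) (`ha`), (b′) rigidity (`hb`), (c′) stabilisation (`hc`),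
(e′) surjectivity (`he`) of AGK Thm. 5, the homological content (h) of the printed proof of Cor. 6
(`hh`), the homotopy-sphere criterion `spc4.S10` (`hS10`) and the injectivity-modulo-stabilisation
half of Thm. 5 with GK Thm. 11 (i) (`hi`); the standard trisections of `S⁴` (d′) are supplied by
(c′) through the tree's genus-`0` trisection of `S⁴` (`sphere_gkTrisections_of_stabilization`,
Gay–Kirby §2).  This is the statement consumed by the route `SmoothPoincare4/GroupTrisection`
(`spc4_of_forall_isStablyTrivial`; `SmoothPoincare4 = SmoothPoincareConjectureFour.{0}`).  The
leaves are deep theorems not proved in the tree, so the unconditional `…_holds` is not available.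
[cite: AbramsGayKirby2018, Cor. 6 (p. 1541)] -/
theorem spc4_iff_forall_isStablyTrivial_of_facts
    (hGK : exists_isBalancedGKTrisection.{0})
    (hχ : gkTrisection_genus_eq_sum_of_homotopyEquiv_sphere.{0})
    (hg : exists_marking_centralSurface_of_gkTrisection.{0})
    (ha : isGroupTrisection_groupGKTrisectionOf.{0})
    (hb : diffeomorph_of_iso_groupGKTrisectionOf.{0})
    (hc : exists_stabilized_gkTrisection.{0})
    (he : exists_gkTrisected_of_isGroupTrisection.{0})
    (hh : isZero_singularHomologyZ_two_of_gkTrisection_three_mul.{0})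
    (hS10 : nonempty_homotopyEquiv_sphere_four_iff.{0})
    (hi : stablyIso_groupGKTrisectionOf_of_diffeomorphic.{0}) :
    spc4_iff_forall_isStablyTrivial.{0} :=
  ⟨fun spc4 k K hK => forall_isStablyTrivial_of_spc4_of_facts he ha hh hS10 hi
      (sphere_gkTrisections_of_stabilization hc) spc4 k K hK,
    fun hst M _ _ _ => spc4_of_forall_isStablyTrivial_of_facts hGK hχ hg ha hb hc
      (sphere_gkTrisections_of_stabilization hc) hst M⟩

/-! ### Universe bookkeeping: (f) does not depend on the universe

`spc4_iff_forall_isStablyTrivial` is universe-polymorphic (the manifolds `M : Type u` on the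
SPC4 side, the trivial group `PUnit : Type u` on the group side), while the assembly above runs
at universe `0` (`S⁴ : Type`; (b′), (e′) compare manifolds of one universe).  Both sides are
universe-independent: a Hausdorff second-countable space is small
(`small_of_secondCountableTopology`), its `C^∞` structure is transported to the copy
`Shrink.{v} M : Type v` along `Shrink.homeomorph` (`Homeomorph.transportChartedSpace`,
`Homeomorph.isManifold_transportChartedSpace`, `Homeomorph.transportDiffeomorph`, as in the
universe lifts of `HomotopyS4SmoothCase.lean`), and a group trisection of one trivial group is a
group trisection of any other (`IsGroupTrisection.punit_of_subsingleton`).  Hence the fact at any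
one universe gives it at every universe, and the universe-`0` assembly gives (f) everywhere. -/

section Universe

universe v

/-- **The smooth Poincaré statement for a space is a topological invariant, across universes**:
if `M ≃ₜ N` and every smooth structure on `N` homotopy equivalent to `Sⁿ` is diffeomorphic to
`Sⁿ`, the same holds for `M` — transport the given `C^∞` structure of `M` to `N` along the
homeomorphism (`Homeomorph.transportChartedSpace`, `Homeomorph.isManifold_transportChartedSpace`),
which then becomes a diffeomorphism (`Homeomorph.transportDiffeomorph`). [folklore] -/
theorem nonemptyDiffeomorphSphere_of_homeomorph {M : Type u} {N : Type v} [TopologicalSpace M]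
    [TopologicalSpace N] (φ : M ≃ₜ N) {n : ℕ}
    (hN : ContinuousMap.HomotopyEquiv.NonemptyDiffeomorphSphere N n) :
    ContinuousMap.HomotopyEquiv.NonemptyDiffeomorphSphere M n := by
  intro _ _ e
  letI := Homeomorph.transportChartedSpace (H := EuclideanSpace ℝ (Fin n)) φ
  haveI := Homeomorph.isManifold_transportChartedSpace (I₀ := 𝓡 n) (n := ∞) φ
  obtain ⟨f⟩ := hN _ inferInstance (φ.symm.toHomotopyEquiv.trans e)
  exact ⟨(Homeomorph.transportDiffeomorph (I₀ := 𝓡 n) (n := ∞) φ).trans f⟩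

/-- **SPC4 does not depend on the universe**: if every Hausdorff second-countable smooth
4-manifold `M : Type v` homotopy equivalent to `S⁴` is diffeomorphic to `S⁴`, the same holds for
every such `M : Type u` — `M` is small (`small_of_secondCountableTopology`), so it is homeomorphic
to `Shrink.{v} M : Type v` (`Shrink.homeomorph`), and `nonemptyDiffeomorphSphere_of_homeomorph`
applies. [folklore] -/
theorem spc4_univ_of_univ
    (h : ∀ (M : Type v) [TopologicalSpace M] [T2Space M] [SecondCountableTopology M],
      ContinuousMap.HomotopyEquiv.NonemptyDiffeomorphSphere M 4)
    (M : Type u) [TopologicalSpace M] [T2Space M] [SecondCountableTopology M] :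
    ContinuousMap.HomotopyEquiv.NonemptyDiffeomorphSphere M 4 := by
  haveI : Small.{v} M := small_of_secondCountableTopology M
  let φ : M ≃ₜ Shrink.{v} M := Shrink.homeomorph M
  haveI : T2Space (Shrink.{v} M) := φ.t2Space
  haveI : SecondCountableTopology (Shrink.{v} M) := φ.symm.secondCountableTopology
  exact nonemptyDiffeomorphSphere_of_homeomorph φ (h (Shrink.{v} M))

/-- **The group side of (f) does not depend on the universe of the trivial group**: a `(3k, k)`
group trisection of `PUnit : Type u` is one of `PUnit : Type v`
(`IsGroupTrisection.punit_of_subsingleton`). [folklore] -/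
theorem forall_isStablyTrivial_univ_of_univ
    (h : ∀ (k : ℕ) (K : TrisectionKernels (3 * k)),
      IsGroupTrisection (3 * k) k (PUnit : Type v) K → K.IsStablyTrivial)
    (k : ℕ) (K : TrisectionKernels (3 * k)) (hK : IsGroupTrisection (3 * k) k (PUnit : Type u) K) :
    K.IsStablyTrivial :=
  h k K hK.punit_of_subsingleton

/-- **(f) at one universe gives (f) at every universe** (`spc4_univ_of_univ` on the manifold
side, `forall_isStablyTrivial_univ_of_univ` on the group side, each used in both directions).
[cite: AbramsGayKirby2018, Cor. 6 (p. 1541)] -/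
theorem spc4_iff_forall_isStablyTrivial_univ_of_univ (h : spc4_iff_forall_isStablyTrivial.{v}) :
    spc4_iff_forall_isStablyTrivial.{u} := by
  refine ⟨fun spc4 k K hK => ?_, fun hst M _ _ _ => ?_⟩
  · have spc4' : ∀ (M : Type v) [TopologicalSpace M] [T2Space M] [SecondCountableTopology M],
        ContinuousMap.HomotopyEquiv.NonemptyDiffeomorphSphere M 4 := spc4_univ_of_univ spc4
    exact forall_isStablyTrivial_univ_of_univ (h.1 spc4') k K hK
  · have hst' : ∀ (k : ℕ) (K : TrisectionKernels (3 * k)),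
        IsGroupTrisection (3 * k) k (PUnit : Type v) K → K.IsStablyTrivial :=
      forall_isStablyTrivial_univ_of_univ hst
    exact spc4_univ_of_univ (h.2 hst') M

/-- **Abrams–Gay–Kirby, Cor. 6 — the named fact (f) at EVERY universe, from the same named facts
at universe `0`** as `spc4_iff_forall_isStablyTrivial_of_facts` (Gay–Kirby Thm. 4 and Remark 2,
the marking fact (g′), the parts (a′), (b′), (c′), (e′) of AGK Thm. 5, the homological content (h)
of the printed proof of Cor. 6, `spc4.S10`, and (i) = Thm. 5 with GK Thm. 11), by
`spc4_iff_forall_isStablyTrivial_univ_of_univ`.  This is the exact shape of the discharge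
`spc4_iff_forall_isStablyTrivial_holds` (implicitly universe-polymorphic), which therefore needs
nothing beyond the ten universe-`0` leaves. [cite: AbramsGayKirby2018, Cor. 6 (p. 1541)] -/
theorem spc4_iff_forall_isStablyTrivial_of_facts_univ
    (hGK : exists_isBalancedGKTrisection.{0})
    (hχ : gkTrisection_genus_eq_sum_of_homotopyEquiv_sphere.{0})
    (hg : exists_marking_centralSurface_of_gkTrisection.{0})
    (ha : isGroupTrisection_groupGKTrisectionOf.{0})
    (hb : diffeomorph_of_iso_groupGKTrisectionOf.{0})
    (hc : exists_stabilized_gkTrisection.{0})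
    (he : exists_gkTrisected_of_isGroupTrisection.{0})
    (hh : isZero_singularHomologyZ_two_of_gkTrisection_three_mul.{0})
    (hS10 : nonempty_homotopyEquiv_sphere_four_iff.{0})
    (hi : stablyIso_groupGKTrisectionOf_of_diffeomorphic.{0}) :
    spc4_iff_forall_isStablyTrivial.{u} :=
  spc4_iff_forall_isStablyTrivial_univ_of_univ
    (spc4_iff_forall_isStablyTrivial_of_facts hGK hχ hg ha hb hc he hh hS10 hi)

end Universe

end Literature.Topology.FourManifolds

end
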